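import Mathlib.Data.Nat.Choose.Basic
import Mathlib.Algebra.Order.BigOperators.Group.Finset
import Mathlib.Algebra.BigOperators.Fin
import Mathlib.Tactic.Linarith
import Mathlib.Tactic.IntervalCases
import Mathlib.Tactic.Ring
import HarnessLib

/-!
# Barrier (Langlands, `GL_n` reciprocity): the Taylor–Wiles "numerical coincidence" fails for `GL_n`

Barrier catalogue entry (D-0021) for the summit `Langlands` (global Langlands reciprocity for
`GL_n` over a number field, both directions).  It records, as printed, the obstruction to running the
Taylor–Wiles patching method (Wiles, Taylor–Wiles 1995; Diamond, Fujiwara, Kisin) directly for `GL_n`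
over a general number field, and PROVES its numerical content.

## What the sources print

* Clozel–Harris–Taylor, *Automorphy for some `l`-adic lifts of automorphic mod `l` Galois
  representations*, Publ. Math. IHÉS 108 (2008), §1, p. 1: "The method of [TW] does not extend to
  `GL_n` as the basic numerical coincidence on which the method depends (see Corollary 2.43 and
  Theorem 4.49 of [DDT]) breaks down.  For the Taylor–Wiles method to work when considering a
  representation `r : Gal(F̄/F) → G(ℚ̄_l)` one needs
  `[F : ℚ](dim G − dim B) = ∑_{v ∣ ∞} dim H⁰(Gal(F̄_v/F_v), ad⁰ r)`       (CHT)
  where `B` denotes a Borel subgroup of a (not necessarily connected) reductive group `G` and `ad⁰`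
  denotes the kernel of the map `ad → ad_G` from `ad` to its `G`-coinvariants.  This is an
  'oddness' condition, which can only hold if `F` is totally real (or `ad⁰ = (0)`) and `r`
  satisfies some sort of self-duality.  For instance one can expect positive results if
  `G = GSp_{2n}` or `G = GO(n)`, but not if `G = GL_n` for `n > 2`."
* Calegari–Geraghty, *Modularity lifting beyond the Taylor–Wiles method*, Invent. Math. 211
  (2018), §1: previous generalisations of Wiles and Taylor–Wiles "ultimately rely on a 'numerical
  coincidence' (see the introduction to [CHT]) which does not hold in general, and does not hold in
  particular for `GL(2)/F` if `F` is not totally real"; in Betti cohomology the relevant invariant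
  is `l₀ = rank G − rank K`, the length of the range of degrees in which tempered cohomological
  representations contribute ([BW]), and the classical method is the case `l₀ = 0`.
* Khare–Thorne, *Potential automorphy and the Leopoldt conjecture*, Amer. J. Math. 139 (2017),
  §6.1, eq. (6.2): for `G = Res_{F/ℚ} GL_n`, `F` with `r₁` real and `r₂` complex places, the defect
  is `l₀ = rank G_∞ − rank Z_∞ K_∞ = r₁ (n−2)/2 + r₂ (n−1)` (`n` even), `r₁ (n−1)/2 + r₂ (n−1)`
  (`n` odd); §1: "If `F` is totally real and `n = 2`, then `X_U` can be given the structure of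
  Hermitian locally symmetric space … In general, however, one expects [the ordinary cohomology]
  should have positive codimension", equal to `l₀`.

## What this file proves (the numerical content, for `G = GL_n`)

For `G = GL_n`: `dim G = n²`, `dim B = n(n+1)/2`, `ad⁰ = 𝔰𝔩_n` (trace-zero matrices, the kernel of
`ad = 𝔤𝔩_n → (𝔤𝔩_n)_{GL_n} = 𝔤𝔩_n/𝔰𝔩_n`), so `dim H⁰(F_v, ad⁰ r)` is `n² − 1` at a complex place
(trivial decomposition group) and `a² + b² − 1` at a real place where the involution `r(c_v)` has
eigenvalue `+1` with multiplicity `a` and `−1` with multiplicity `b = n − a` (its centraliser in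
`𝔰𝔩_n` is the block-diagonal trace-zero matrices).  With these values (definitions `chtLHS`,
`chtRHS` below, each carrying its derivation) we prove

* `TaylorWilesNumericalCoincidence_holds`: for `n ≥ 1`, (CHT) holds for `GL_n` **iff** `n = 1`, or
  `n = 2`, `F` is totally real (`r₂ = 0`) and `r(c_v)` is odd (`a_v = b_v = 1`) at every real place;
  in particular it fails for every `n ≥ 3`, for every `F` with a complex place when `n ≥ 2`, and for
  even two-dimensional `r` — exactly the printed scope "only if `F` is totally real … not if
  `G = GL_n` for `n > 2`";
* `chtLHS_le_chtRHS`: the left side never exceeds the right side (the failure is always a deficit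
  of Taylor–Wiles primes, never a surplus);
* `chtRHS_eq_chtLHS_add_defectGL`: for `r` odd at every real place (balanced signatures) the deficit
  is *exactly* the defect, `RHS = LHS + l₀` — Hansen's form of the coincidence in positive defect;
* `defectGL_eq_zero_iff`: the Khare–Thorne defect `l₀(Res_{F/ℚ} GL_n)` vanishes iff `n ≤ 1` or
  (`n = 2` and `r₂ = 0`), the Betti-cohomology form of the same restriction (Calegari–Geraghty §1).

Nothing here is specific to a proof assistant: the two computations are routine and are the ones
the cited introductions allude to.  The BARRIER block is on `TaylorWilesNumericalCoincidence`.

## Barrier audit (D-0021): the scope of `blocks:` narrowed to non-polarizable `r`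

The criterion above is evaluated for the group `G = GL_n`.  The same introduction of
Clozel–Harris–Taylor continues (p. 2): "This choice [of the disconnected group `𝒢_n`] can give us
information about certain Galois representations `r : Gal(F̄/F) → GL_n(ℚ̄_l)`, where `F` is a CM
field. If `c` denotes complex conjugation then the representations `r` which arise all have the
following property: There is a non-degenerate symmetric pairing `⟨ , ⟩` on `ℚ̄_lⁿ` and a character
`χ` … such that `⟨σx, cσc⁻¹y⟩ = χ(σ)⟨x, y⟩` … In this setting the Taylor–Wiles argument carries over
well, and we are able to prove `R = T` theorems in the 'minimal' case."  The section
`## Narrowing` below evaluates (CHT) for `G = 𝒢_n = (GL_n × GL_1) ⋊ {1, j}` over a totally real `F⁺`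
(`dim 𝒢_n − dim B = C(n,2)`; `ad⁰ = ad = 𝔤𝔩_n`, since `𝔤_n^{𝒢_n} = (0)` over `ℤ[1/2]`, CHT §2.1
p. 7, and likewise the coinvariants vanish, `j` acting by `−1` on the trace; `r(c_v) = (A_v, −χ(c_v))j`
acts by `x ↦ −A_v ᵗx A_v⁻¹`, CHT Lemma 2.1.1) and PROVES that it holds in **every** dimension `n` iff
the pairing `ᵗx A_v⁻¹ y` is symmetric at every real place (`χ(c_v) = ν ∘ r(c_v) = −1`; "totally odd,
essentially conjugate self-dual", `ε_v = 1`, Barnet-Lamb–Gee–Geraghty–Taylor §2.1 p. 17), failing by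
exactly `n` per place of alternating sign (`chtCoincidenceGn_iff`, `chtRHSGn_eq_chtLHSGn_add`).  This
is the count Clozel–Harris–Taylor themselves print: the archimedean term of their Euler characteristic
is `∑_{v∣∞} n(n + χ(c_v))/2` (Lemma 2.3.4 (5), p. 31), the Taylor–Wiles rings `R_{S(Q_N)}` are
generated over the local ring by `#Q − ∑_{v∈T, v∣l} [F⁺_v : ℚ_l] n(n−1)/2 − n ∑_{v∣∞} (1 + χ(c_v))/2`
elements (Lemma 2.5.8, Prop. 2.5.9, pp. 60–61), and balance forces "`χ(c_v) = −1` for all `v ∣ ∞`"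
(Cor. 2.3.6, p. 33; a standing hypothesis of their lifting theorems, e.g. Thm. 2.6.3, p. 64).
So defect-zero patching is NOT blocked for polarizable, totally odd `r` of any dimension (the
RACSDC/RAESDC world of CHT, BLGGT; Booher §1 p. 4: "This coincidence cannot hold for `GL_n` when
`n > 2`, but can hold for `G = GSp_{2n}` and `G = GO_m` when `m ≢ 2 (mod 4)`, and for the group
`𝒢_n` related to `GL_n` considered in [CHT08]"), and the barrier proper is the narrower
`TaylorWilesNumericalCoincidenceNarrow` (second BARRIER block below), whose `blocks:` line is
restricted accordingly.

## References

* [CHT2008] L. Clozel, M. Harris, R. Taylor, Publ. Math. IHÉS 108 (2008) 1–181, §1 (pp. 1–2);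
  for the narrowing also §2.1 (p. 7, the group `𝒢_n`, Lemma 2.1.1), §2.3 (Lemma 2.3.4 (5),
  Cor. 2.3.5, Cor. 2.3.6, pp. 31–33) and §2.5 (Lemma 2.5.8, Prop. 2.5.9, pp. 60–61).
  [cite: ClozelHarrisTaylor2008, §1]
* [CG2018] F. Calegari, D. Geraghty, Invent. Math. 211 (2018) 297–433, §1 (Thm. 1.1 conditional on
  Conj. A; Thm. 1.3 weight one). [cite: CalegariGeraghty2017, §1]
* [KT2017] C. Khare, J. Thorne, Amer. J. Math. 139 (2017) 1205–1273, §1 eq. (1.1), §6.1 eq. (6.2).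
  [cite: KhareThorne2017, §6.1]
* [ACC+2023] P. Allen, F. Calegari, A. Caraiani, T. Gee, D. Helm, B. Le Hung, J. Newton, P. Scholze,
  R. Taylor, J. Thorne, Ann. of Math. 197 (2023) 897–1113, §1. [cite: ACCGHLNSTT2023, §1]
* [Sch2015] P. Scholze, Ann. of Math. 182 (2015) 945–1066, §1, Thm. 1.0.3. [cite: Scholze2015, §1]
* [TW1995] R. Taylor, A. Wiles, Ann. of Math. 141 (1995) 553–572. [cite: TaylorWiles1995Annals]
* [Cal2023] F. Calegari, ICM 2022 Vol. 2, 610–651, §9.7, §10.1. [cite: Calegari2023, §9.7]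
* [Han2012] D. Hansen, *Minimal modularity lifting for GL₂ over an arbitrary number field*, arXiv:1209.5309, §1
  (the identity `[F:ℚ](dim G − dim B) + l(G) = ∑_{v∣∞} dim H⁰(F_v, ad⁰ r̄)`). [cite: Hansen2012, §1]
* [BLGGT2014] T. Barnet-Lamb, T. Gee, D. Geraghty, R. Taylor, *Potential automorphy and change of
  weight*, Ann. of Math. 179 (2014) 501–609, §2.1 (p. 17: "totally odd, essentially conjugate
  self-dual": `ε_v = 1` for all `v ∣ ∞`). [cite: BarnetlambEtAl2014, §2.1]
* [Boo2019] J. Booher, *Producing geometric deformations of orthogonal and symplectic Galois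
  representations*, J. Number Theory 195 (2019) 115–158, §1 (p. 4, Remark 2), §3 (p. 11,
  Remark 23). [cite: Booher2019, §1]
* [BV2013] N. Bergeron, A. Venkatesh, *The asymptotic growth of torsion homology for arithmetic
  groups*, J. Inst. Math. Jussieu 12 (2013) 391–447, §6 (Proposition 7 of arXiv:1004.1083, p. 21:
  involutions in the `L`-group over `c` have adjoint trace `≥ rank G − 2 rank K`, with equality on
  one orbit, the odd class). [cite: BergeronVenkatesh2012, §6]
-/

namespace Literature.Barriers.Langlands

open Finset

/-! ## Dimensions for `G = GL_n` -/

/-- `dim GL_n = n²`. [folklore] -/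
def dimGL (n : ℕ) : ℕ := n ^ 2

/-- `dim B = n(n+1)/2` for a Borel subgroup `B ⊂ GL_n` (invertible upper-triangular matrices),
written as the binomial coefficient `C(n+1, 2) = (n+1)n/2` (`dimBorelGL_eq`). [folklore] -/
def dimBorelGL (n : ℕ) : ℕ := (n + 1).choose 2

/-- `dim B = (n+1)·n/2`. [folklore] -/
theorem dimBorelGL_eq (n : ℕ) : dimBorelGL n = (n + 1) * n / 2 := by
  simp [dimBorelGL, Nat.choose_two_right]

/-- `n² = n + 2·C(n,2)`. [folklore] -/
theorem sq_eq_add_two_mul_choose_two (n : ℕ) : n ^ 2 = n + 2 * n.choose 2 := by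
  induction n with
  | zero => simp
  | succ n ih =>
    rw [Nat.choose_succ_succ, Nat.choose_one_right]
    nlinarith [ih]

/-- `dim GL_n − dim B = C(n,2) = n(n−1)/2` (the dimension of the unipotent radical of the opposite
Borel). [folklore] -/
theorem dimGL_sub_dimBorelGL (n : ℕ) : dimGL n - dimBorelGL n = n.choose 2 := by
  have h1 : dimBorelGL n = n + n.choose 2 := by
    simp [dimBorelGL, Nat.choose_succ_succ, Nat.choose_one_right]
  have h2 := sq_eq_add_two_mul_choose_two n
  simp only [dimGL, h1]
  omega

/-! ## Archimedean data of `r : Gal(F̄/F) → GL_n(ℚ̄_l)` and the two sides of (CHT) -/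

/-- The archimedean data entering (CHT) for an `n`-dimensional representation `r` of `Gal(F̄/F)`,
`F` a number field with `r₁` real places and `r₂` complex places (`r₁ + r₂ ≥ 1`): at each real place
`v` the image `r(c_v)` of complex conjugation is an involution, recorded by the multiplicity
`plusMult v ≤ n` of its eigenvalue `+1` (so `−1` has multiplicity `n − plusMult v`); at a complex
place the decomposition group is trivial and there is nothing to record.
[cite: ClozelHarrisTaylor2008, §1] -/
structure ArchData (n : ℕ) where
  /-- number of real places of `F` -/
  r₁ : ℕ
  /-- number of complex places of `F` -/
  r₂ : ℕ
  /-- multiplicity of the eigenvalue `+1` of `r(c_v)` at the real place `v` -/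
  plusMult : Fin r₁ → ℕ
  plusMult_le : ∀ v, plusMult v ≤ n
  places_pos : 0 < r₁ + r₂

/-- `dim H⁰(Gal(ℂ/ℝ), ad⁰ r) = a² + (n−a)² − 1` at a real place where `r(c)` has eigenvalue `+1`
with multiplicity `a` and `−1` with multiplicity `n − a`: the fixed points of `Ad r(c)` on
`ad⁰ = 𝔰𝔩_n` are the block-diagonal matrices (blocks of sizes `a`, `n − a`) of trace zero.  (For
`n = 2`: `1` if `r` is odd, `3` if `r` is even.)  Junk value `0` only for `n = 0`.
[cite: ClozelHarrisTaylor2008, §1] -/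
def h0Real (n a : ℕ) : ℕ := a ^ 2 + (n - a) ^ 2 - 1

/-- `dim H⁰(Gal(ℂ/ℂ), ad⁰ r) = dim 𝔰𝔩_n = n² − 1` at a complex place (trivial decomposition group).
[cite: ClozelHarrisTaylor2008, §1] -/
def h0Complex (n : ℕ) : ℕ := n ^ 2 - 1

variable {n : ℕ}

/-- Left side of (CHT) for `G = GL_n`: `[F : ℚ](dim G − dim B)` with `[F : ℚ] = r₁ + 2 r₂`.
[cite: ClozelHarrisTaylor2008, §1] -/
def chtLHS (D : ArchData n) : ℕ := (D.r₁ + 2 * D.r₂) * (dimGL n - dimBorelGL n)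

/-- Right side of (CHT) for `G = GL_n`: `∑_{v ∣ ∞} dim H⁰(Gal(F̄_v/F_v), ad⁰ r)`, the sum of `h0Real`
over the real places and of `h0Complex` over the complex places. [cite: ClozelHarrisTaylor2008, §1] -/
def chtRHS (D : ArchData n) : ℕ := (∑ v, h0Real n (D.plusMult v)) + D.r₂ * h0Complex n

/-- The Taylor–Wiles **numerical coincidence** of Clozel–Harris–Taylor for `G = GL_n` and the
archimedean data `D` of `r`: `[F : ℚ](dim G − dim B) = ∑_{v ∣ ∞} dim H⁰(F_v, ad⁰ r)`.
[cite: ClozelHarrisTaylor2008, §1] -/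
def CHTCoincidenceGL (D : ArchData n) : Prop := chtLHS D = chtRHS D

/-! ## The defect `l₀` of Borel–Wallach / Calegari–Geraghty / Khare–Thorne for `Res_{F/ℚ} GL_n` -/

/-- The **defect** `l₀ = rank G_∞ − rank Z_∞ K_∞` of `G = Res_{F/ℚ} GL_n` for a number field `F`
with `r₁` real and `r₂` complex places, in the closed form printed by Khare–Thorne, eq. (6.2):
`r₁ (n−2)/2 + r₂ (n−1)` for `n` even and `r₁ (n−1)/2 + r₂ (n−1)` for `n` odd; both cases equal
`r₁ ⌊(n−1)/2⌋ + r₂ (n−1)` (`defectGL_even`, `defectGL_odd`).  It is the length of the range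
`[q₀, q₀ + l₀]` of degrees in which cuspidal cohomological representations contribute to the
cohomology of the locally symmetric spaces of `G` (Borel–Wallach; Khare–Thorne §1, eq. (1.1);
Allen et al. 2023, Thm. 2.4.9 for `F` CM), and the classical Taylor–Wiles method is the case
`l₀ = 0` (Calegari–Geraghty §1). [cite: KhareThorne2017, §6.1 eq. (6.2)] -/
def defectGL (r₁ r₂ n : ℕ) : ℕ := r₁ * ((n - 1) / 2) + r₂ * (n - 1)

/-- Khare–Thorne's printed form for `n` even. [cite: KhareThorne2017, §6.1 eq. (6.2)] -/
theorem defectGL_even {r₁ r₂ n : ℕ} (hn : Even n) :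
    defectGL r₁ r₂ n = r₁ * ((n - 2) / 2) + r₂ * (n - 1) := by
  obtain ⟨k, rfl⟩ := hn
  have : (k + k - 1) / 2 = (k + k - 2) / 2 := by omega
  simp [defectGL, this]

/-- Khare–Thorne's printed form for `n` odd — it is the closed form used to define `defectGL`, so it
holds by `rfl` for every `n` (the printed case split is `defectGL_even` / this lemma).
[cite: KhareThorne2017, §6.1 eq. (6.2)] -/
theorem defectGL_odd (r₁ r₂ n : ℕ) :
    defectGL r₁ r₂ n = r₁ * ((n - 1) / 2) + r₂ * (n - 1) := rfl

/-- Khare–Thorne's totally complex special case: `l₀ = (n − 1)[F : ℚ]/2 = (n−1) r₂` when `r₁ = 0`.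
[cite: KhareThorne2017, §6.1] -/
theorem defectGL_totallyComplex (r₂ n : ℕ) : defectGL 0 r₂ n = r₂ * (n - 1) := by
  simp [defectGL]

/-- **The defect vanishes exactly for `GL_1` and for `GL_2` over totally real fields**: for a number
field with `r₁ + r₂ ≥ 1` places, `l₀(Res_{F/ℚ} GL_n) = 0 ↔ n ≤ 1 ∨ (n = 2 ∧ r₂ = 0)`.  This is the
Betti-cohomological form of the restriction "totally real and `n ≤ 2`" (Khare–Thorne §1;
Calegari–Geraghty §1: the method needs the cohomology in a single degree, i.e. `l₀ = 0`).
[cite: KhareThorne2017, §1 and §6.1] [cite: CalegariGeraghty2017, §1] -/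
theorem defectGL_eq_zero_iff {r₁ r₂ n : ℕ} (h : 0 < r₁ + r₂) :
    defectGL r₁ r₂ n = 0 ↔ n ≤ 1 ∨ (n = 2 ∧ r₂ = 0) := by
  simp only [defectGL, Nat.add_eq_zero_iff, Nat.mul_eq_zero]
  omega

/-! ## Place-by-place comparison of the two sides of (CHT) -/

/-- `2·C(n,2) = n(n−1)` over `ℤ`. [folklore] -/
theorem two_mul_choose_two_int (n : ℕ) :
    (2 : ℤ) * (n.choose 2 : ℕ) = (n : ℤ) * ((n : ℤ) - 1) := by
  have h := sq_eq_add_two_mul_choose_two n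
  have h' : ((n : ℤ)) ^ 2 = (n : ℤ) + 2 * (n.choose 2 : ℕ) := by exact_mod_cast h
  nlinarith [h']

/-- **Real places.** `C(n,2) ≤ dim H⁰(ℝ, ad⁰ r) = a² + (n−a)² − 1` for every signature `(a, n − a)`,
`n ≥ 1`. [cite: ClozelHarrisTaylor2008, §1] -/
theorem choose_two_le_h0Real {n a : ℕ} (hn : 1 ≤ n) (ha : a ≤ n) : n.choose 2 ≤ h0Real n a := by
  obtain ⟨b, rfl⟩ := Nat.exists_eq_add_of_le ha
  have hsq : 1 ≤ a ^ 2 + b ^ 2 := by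
    rcases Nat.eq_zero_or_pos a with rfl | ha0
    · simp at hn; nlinarith
    · nlinarith
  simp only [h0Real, Nat.add_sub_cancel_left]
  zify [hsq]
  have h2 := two_mul_choose_two_int (a + b)
  have hsq' : (1 : ℤ) ≤ (a : ℤ) ^ 2 + (b : ℤ) ^ 2 := by exact_mod_cast hsq
  push_cast at h2 ⊢
  rcases Nat.lt_or_ge (a + b) 2 with hlt | hge
  · have hab : (a : ℤ) + b = 1 := by exact_mod_cast (show a + b = 1 by omega)
    rw [hab] at h2
    norm_num at h2
    rw [h2]
    push_cast
    linarith
  · have hge' : (2 : ℤ) ≤ (a : ℤ) + (b : ℤ) := by exact_mod_cast hge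
    nlinarith [sq_nonneg ((a : ℤ) - (b : ℤ))]

/-- **Real places, equality.** `dim H⁰(ℝ, ad⁰ r) = C(n,2)` iff `n = 1`, or `n = 2` and `r(c)` is odd
(`a = 1`). [cite: ClozelHarrisTaylor2008, §1] -/
theorem h0Real_eq_choose_two_iff {n a : ℕ} (hn : 1 ≤ n) (ha : a ≤ n) :
    h0Real n a = n.choose 2 ↔ n = 1 ∨ (n = 2 ∧ a = 1) := by
  constructor
  · intro heq
    obtain ⟨b, rfl⟩ := Nat.exists_eq_add_of_le ha
    have hsq : 1 ≤ a ^ 2 + b ^ 2 := by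
      rcases Nat.eq_zero_or_pos a with rfl | ha0
      · simp at hn; nlinarith
      · nlinarith
    simp only [h0Real, Nat.add_sub_cancel_left] at heq
    have h2 := two_mul_choose_two_int (a + b)
    have heq' : ((a : ℤ)) ^ 2 + (b : ℤ) ^ 2 - 1 = ((a + b).choose 2 : ℕ) := by
      have : ((a ^ 2 + b ^ 2 - 1 : ℕ) : ℤ) = (a : ℤ) ^ 2 + (b : ℤ) ^ 2 - 1 := by
        push_cast [Nat.cast_sub hsq]; ring
      rw [← this, heq]
    push_cast at h2
    -- `2 (a² + b² − 1) = (a+b)(a+b−1)`, i.e. `(a−b)² + (a+b) = 2`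
    have key : ((a : ℤ) - b) ^ 2 + (a + b) = 2 := by nlinarith [heq', h2]
    have hab : a + b ≤ 2 := by
      have : ((a : ℤ) + b) ≤ 2 := by nlinarith [sq_nonneg ((a : ℤ) - b), key]
      exact_mod_cast this
    have ha2 : a ≤ 2 := by omega
    have hb2 : b ≤ 2 := by omega
    interval_cases a <;> interval_cases b <;> simp_all
  · rintro (rfl | ⟨rfl, rfl⟩)
    · interval_cases a <;> simp [h0Real]
    · simp [h0Real]

/-- **Complex places.** `2·C(n,2) ≤ dim H⁰(ℂ, ad⁰ r) = n² − 1` for `n ≥ 1` (a complex place counts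
twice in `[F : ℚ]`). [cite: ClozelHarrisTaylor2008, §1] -/
theorem two_mul_choose_two_le_h0Complex {n : ℕ} (hn : 1 ≤ n) : 2 * n.choose 2 ≤ h0Complex n := by
  have h := sq_eq_add_two_mul_choose_two n
  simp only [h0Complex]
  omega

/-- **Complex places, equality.** `n² − 1 = 2·C(n,2)` iff `n = 1`. [cite: ClozelHarrisTaylor2008, §1] -/
theorem h0Complex_eq_iff {n : ℕ} (hn : 1 ≤ n) : h0Complex n = 2 * n.choose 2 ↔ n = 1 := by
  have h := sq_eq_add_two_mul_choose_two n
  simp only [h0Complex]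
  omega

/-! ## The comparison of the two sides -/

/-- The left side of (CHT), rewritten place by place: `[F:ℚ]·C(n,2) = ∑_{v real} C(n,2) +
r₂ · (2·C(n,2))`. [cite: ClozelHarrisTaylor2008, §1] -/
theorem chtLHS_eq (D : ArchData n) :
    chtLHS D = (∑ _v : Fin D.r₁, n.choose 2) + D.r₂ * (2 * n.choose 2) := by
  simp [chtLHS, dimGL_sub_dimBorelGL]
  ring

/-- **(CHT) can only fail by a deficit**: `[F : ℚ](dim G − dim B) ≤ ∑_{v ∣ ∞} dim H⁰(F_v, ad⁰ r)`
for `G = GL_n`, `n ≥ 1`. [cite: ClozelHarrisTaylor2008, §1] -/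
theorem chtLHS_le_chtRHS (D : ArchData n) (hn : 1 ≤ n) : chtLHS D ≤ chtRHS D := by
  rw [chtLHS_eq]
  unfold chtRHS
  gcongr with v
  · exact choose_two_le_h0Real hn (D.plusMult_le v)
  · exact two_mul_choose_two_le_h0Complex hn

/-- **The numerical coincidence for `GL_n`, decided.**  For `n ≥ 1` and archimedean data `D`
(`r₁` real places with signatures, `r₂` complex places, `r₁ + r₂ ≥ 1`), (CHT) holds iff `n = 1`,
or `n = 2`, `r₂ = 0` and `r(c_v)` is odd at every real place. [cite: ClozelHarrisTaylor2008, §1] -/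
theorem chtCoincidenceGL_iff (D : ArchData n) (hn : 1 ≤ n) :
    CHTCoincidenceGL D ↔ n = 1 ∨ (n = 2 ∧ D.r₂ = 0 ∧ ∀ v, D.plusMult v = 1) := by
  unfold CHTCoincidenceGL
  rw [chtLHS_eq]
  unfold chtRHS
  have hsum : (∑ _v : Fin D.r₁, n.choose 2) ≤ ∑ v, h0Real n (D.plusMult v) :=
    Finset.sum_le_sum fun v _ => choose_two_le_h0Real hn (D.plusMult_le v)
  have hcx : D.r₂ * (2 * n.choose 2) ≤ D.r₂ * h0Complex n :=
    Nat.mul_le_mul_left _ (two_mul_choose_two_le_h0Complex hn)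
  have hsumiff : (∑ _v : Fin D.r₁, n.choose 2) = ∑ v, h0Real n (D.plusMult v) ↔
      ∀ v, n = 1 ∨ (n = 2 ∧ D.plusMult v = 1) := by
    rw [Finset.sum_eq_sum_iff_of_le fun v _ => choose_two_le_h0Real hn (D.plusMult_le v)]
    simp only [Finset.mem_univ, forall_const]
    refine forall_congr' fun v => ?_
    rw [eq_comm, h0Real_eq_choose_two_iff hn (D.plusMult_le v)]
  have hcxiff : D.r₂ * (2 * n.choose 2) = D.r₂ * h0Complex n ↔ D.r₂ = 0 ∨ n = 1 := by
    rcases Nat.eq_zero_or_pos D.r₂ with h0 | hpos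
    · simp [h0]
    · rw [Nat.mul_left_cancel_iff hpos, eq_comm, h0Complex_eq_iff hn]
      omega
  constructor
  · intro h
    have h1 : (∑ _v : Fin D.r₁, n.choose 2) = ∑ v, h0Real n (D.plusMult v) := by omega
    have h2 : D.r₂ * (2 * n.choose 2) = D.r₂ * h0Complex n := by omega
    rw [hsumiff] at h1
    rw [hcxiff] at h2
    have hp := D.places_pos
    rcases h2 with h2 | h2
    · -- `F` totally real: there is a real place
      have hr₁ : 0 < D.r₁ := by omega
      rcases h1 ⟨0, hr₁⟩ with h | ⟨h, -⟩
      · exact Or.inl h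
      · refine Or.inr ⟨h, h2, fun v => ?_⟩
        rcases h1 v with h' | ⟨-, h'⟩
        · omega
        · exact h'
    · exact Or.inl h2
  · rintro (rfl | ⟨rfl, hr₂, hodd⟩)
    · have h1 : (∑ _v : Fin D.r₁, (1 : ℕ).choose 2) = ∑ v, h0Real 1 (D.plusMult v) :=
        hsumiff.2 fun v => Or.inl rfl
      have h2 : D.r₂ * (2 * (1 : ℕ).choose 2) = D.r₂ * h0Complex 1 := hcxiff.2 (Or.inr rfl)
      omega
    · have h1 : (∑ _v : Fin D.r₁, (2 : ℕ).choose 2) = ∑ v, h0Real 2 (D.plusMult v) :=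
        hsumiff.2 fun v => Or.inr ⟨rfl, hodd v⟩
      rw [h1, hr₂, zero_mul, zero_mul]

/-! ## The barrier -/

/-- **BARRIER: the Taylor–Wiles numerical coincidence (defect-zero patching) fails for `GL_n`.**
Clozel–Harris–Taylor, §1: for the Taylor–Wiles method to work for `r : Gal(F̄/F) → G(ℚ̄_l)` one needs
`[F : ℚ](dim G − dim B) = ∑_{v ∣ ∞} dim H⁰(Gal(F̄_v/F_v), ad⁰ r)`, "an 'oddness' condition, which can
only hold if `F` is totally real (or `ad⁰ = (0)`) and `r` satisfies some sort of self-duality … not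
if `G = GL_n` for `n > 2`."  The Prop below is the decided form of this criterion for `G = GL_n`
(`dim G = n²`, `dim B = n(n+1)/2`, `ad⁰ = 𝔰𝔩_n`): for every `n ≥ 1` and every archimedean datum
(`r₁` real places with the signatures of the involutions `r(c_v)`, `r₂` complex places), the
coincidence holds **iff** `n = 1`, or `n = 2`, `F` is totally real and `r` is odd at every real
place.  PROVED below (`TaylorWilesNumericalCoincidence_holds`); companion facts: the failure is
always a deficit (`chtLHS_le_chtRHS`), and the Betti-cohomological defect
`l₀(Res_{F/ℚ} GL_n) = r₁ ⌊(n−1)/2⌋ + r₂ (n−1)` (Khare–Thorne (6.2)) vanishes iff `n ≤ 1` or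
(`n = 2` and `r₂ = 0`) (`defectGL_eq_zero_iff`); for odd `r` the deficit is exactly `l₀`
(`chtRHS_eq_chtLHS_add_defectGL`, Hansen's form).

BARRIER (structured block, D-0021):
- technique_class: taylor-wiles patching automorphy-lifting defect-zero
- blocks: automorphy (Galois → automorphic direction of the summit `Langlands`; the tree's `Literature.NumberTheory.Automorphic.FontaineMazurLanglandsGLn`, `Literature/NumberTheory/Automorphic/ReciprocityGLn`) of `r : Gal(F̄/F) → GL_n(ℚ̄_l)` by the Taylor–Wiles–Kisin patching argument run in a single cohomological degree, whenever `n ≥ 3`, or `F` has a complex place (`n ≥ 2`), or `n = 2` and `r` is even at some real place [cite: ClozelHarrisTaylor2008, §1] [cite: CalegariGeraghty2017, §1]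
- because: patching needs as many Taylor–Wiles relations as generators; the Greenberg–Wiles Euler-characteristic count (DDT Cor. 2.43 / Thm. 4.49 as cited in CHT §1) makes the two numbers agree exactly when (CHT) holds, and for `GL_n` the archimedean terms `dim H⁰(F_v, 𝔰𝔩_n)` (`= n² − 1` at complex `v`, `= a² + b² − 1 ≥ C(n,2)` at real `v`) exceed `[F_v : ℝ]·(dim G − dim B) = [F_v : ℝ]·C(n,2)` unless `n ≤ 2`, `v` real and `r(c_v)` odd (this file); equivalently the cuspidal cohomology of the locally symmetric spaces of `Res_{F/ℚ} GL_n` is spread over `l₀ + 1` degrees with `l₀ > 0` (Borel–Wallach range, [cite: KhareThorne2017, §1 eq. (1.1), §6.1 eq. (6.2)]), while the classical method needs it in one degree [cite: CalegariGeraghty2017, §1]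
- evasions_known: (i) change the group: for `F` CM and `r` conjugate self-dual (times a character) work on a definite unitary group / the disconnected group `𝒢_n`, where the coincidence holds — Clozel–Harris–Taylor's `R = T` and automorphy lifting for RACSDC representations [cite: ClozelHarrisTaylor2008, §1]; (ii) positive defect: Calegari–Geraghty patch complexes over `l₀ + 1` degrees, proving minimal modularity lifting for `GL_2` over imaginary quadratic `F` (`l₀ = 1`) conditional on the existence and local–global compatibility of Galois representations for torsion classes (their Conj. A), and unconditionally in weight one over `ℚ` via coherent cohomology [cite: CalegariGeraghty2017, §1 Thm. 1.1, Thm. 1.3]; (iii) Allen–Calegari–Caraiani–Gee–Helm–Le Hung–Newton–Scholze–Taylor–Thorne make (ii) unconditional for `n`-dimensional regular representations over CM fields (ordinary or Fontaine–Laffaille at `p`, residual image conditions), using Scholze's torsion Galois representations and Caraiani–Scholze vanishing, without any self-duality hypothesis; both the automorphy lifting theorems and the potential automorphy they yield (elliptic curves, `Sym^m`) are over CM `F` ("Let `F` be a CM number field", abstract); over a field `F` that is neither totally real nor CM (so that no finite extension of `F` is CM either, subfields of CM fields being totally real or CM) no automorphy lifting theorem by patching, in any defect, is presently available for a general `r`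 with `n ≥ 2`, the Galois representations attached to torsion classes being constructed over CM fields [cite: ACCGHLNSTT2023, §1] [cite: Scholze2015, §1]; (iv) `n = 2` over `ℚ`, `r` even with distinct Hodge–Tate weights: `Sym² r` restricted to a CM field is conjugate self-dual and "no longer sees the evenness", so the potential automorphy machinery applies to it and yields the predicted non-existence of such `r` (Calegari; big-image hypotheses remain), while "this trick has nothing to say about the case when the Hodge–Tate weights are equal" [cite: Calegari2023, §9.7]
- scope_caveats: (a) the Prop evaluates the criterion for `G = GL_n`-valued deformation theory only; the `blocks:` line above is therefore too wide as a statement about the technique class — for `r` admitting a totally odd polarization (`F` CM and `r^c ≅ r^∨ ⊗ χ`, or `F` totally real and `r ≅ r^∨ ⊗ χ`, with symmetric CHT pairing at every `v ∣ ∞`, [cite: BarnetlambEtAl2014, §2.1]) the same defect-zero patching meets no numerical obstruction in any dimension through `G = 𝒢_n` (resp. `GSp_n`, `GO_n`), where the coincidence holds (CHT §1 p. 2; proved below, `chtCoincidenceGn_iff`), and is carried out there (CHT's minimal `R = 𝕋`, Thm. 3.5.1, p. 113, and modularity lifting Thms. 4.4.2–4.4.3; [Tay], BLGGT for the non-minimal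 case); the operative barrier is `TaylorWilesNumericalCoincidenceNarrow` (audit 2026-08-14) [cite: ClozelHarrisTaylor2008, §1] [cite: Booher2019, §1]; (b) the left side `[F : ℚ](dim G − dim B)` presumes distinct Hodge–Tate weights at every `v ∣ p` ("A second requirement of these generalizations is that the Galois representations in question are regular at `∞`, that is, have distinct Hodge–Tate weights for all `v | p`", [cite: CalegariGeraghty2017, §1]); irregular weight lowers the `p`-adic term and is a further failure (weight one, limits of discrete series), not an evasion; (c) `l > 2` and fixed polarization/determinant (`ad⁰`) are presumed; (d) the criterion is CHT's diagnosis of the method of [TW]/[DDT] as they formulate it (one cohomological degree, `G`-valued deformation theory); it is not a theorem that no argument by patching can succeed — (ii)–(iii) are patching arguments in positive defect [cite: CalegariGeraghty2017, §1]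
- status: established (the numerical criterion evaluated for `GL_n` is proved here as `TaylorWilesNumericalCoincidence_holds`; the attribution of the requirement to the method is CHT's [cite: ClozelHarrisTaylor2008, §1])
-/
def TaylorWilesNumericalCoincidence : Prop :=
  ∀ (n : ℕ) (D : ArchData n), 1 ≤ n →
    (CHTCoincidenceGL D ↔ n = 1 ∨ (n = 2 ∧ D.r₂ = 0 ∧ ∀ v, D.plusMult v = 1))

/-- Discharge of `TaylorWilesNumericalCoincidence` (proved in this file, `chtCoincidenceGL_iff`).
[cite: ClozelHarrisTaylor2008, §1] -/
theorem TaylorWilesNumericalCoincidence_holds : TaylorWilesNumericalCoincidence :=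
  fun _n D hn => chtCoincidenceGL_iff D hn

/-- Corollary as printed ("not if `G = GL_n` for `n > 2`"): for `n ≥ 3` the coincidence fails for
every number field and every `r`. [cite: ClozelHarrisTaylor2008, §1] -/
theorem not_chtCoincidenceGL_of_three_le (D : ArchData n) (hn : 3 ≤ n) : ¬ CHTCoincidenceGL D := by
  rw [chtCoincidenceGL_iff D (by omega)]
  omega

/-- Corollary as printed ("can only hold if `F` is totally real"; Calegari–Geraghty: "does not hold
in particular for `GL(2)/F` if `F` is not totally real"): if `F` has a complex place and `n ≥ 2`
the coincidence fails. [cite: ClozelHarrisTaylor2008, §1] [cite: CalegariGeraghty2017, §1] -/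
theorem not_chtCoincidenceGL_of_complexPlace (D : ArchData n) (hn : 2 ≤ n) (hr : 0 < D.r₂) :
    ¬ CHTCoincidenceGL D := by
  rw [chtCoincidenceGL_iff D (by omega)]
  omega

/-- Corollary as printed ("an 'oddness' condition"): for `n = 2` over a totally real field the
coincidence holds iff `r` is odd at every real place. [cite: ClozelHarrisTaylor2008, §1] -/
theorem chtCoincidenceGL_two_iff (D : ArchData 2) (hr : D.r₂ = 0) :
    CHTCoincidenceGL D ↔ ∀ v, D.plusMult v = 1 := by
  rw [chtCoincidenceGL_iff D (by omega)]
  simp [hr]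

/-! ## Hansen's form: the deficit in (CHT) is exactly the defect `l₀` for odd `r` -/

/-- A real signature `(a, n − a)` is **balanced** ("odd" in Hansen's sense `|tr r̄(c_v)| ≤ 1`):
`|a − (n − a)| ≤ 1`. [cite: Hansen2012, §1] -/
def IsBalancedSignature (n a : ℕ) : Prop := 2 * a = n ∨ 2 * a = n + 1 ∨ 2 * a + 1 = n

/-- At a real place with balanced signature the local term exceeds `C(n,2)` by exactly
`⌊(n−1)/2⌋`, the real-place contribution to `l₀` (Khare–Thorne (6.2)). [cite: Hansen2012, §1] -/
theorem h0Real_eq_of_isBalanced {n a : ℕ} (hn : 1 ≤ n) (h : IsBalancedSignature n a) :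
    h0Real n a = n.choose 2 + (n - 1) / 2 := by
  rcases h with h | h | h
  · -- `n = 2a`
    subst h
    have ha : 1 ≤ a := by omega
    have hdiv : (2 * a - 1) / 2 = a - 1 := by omega
    have hsub : 2 * a - a = a := by omega
    rw [hdiv, h0Real, hsub]
    have h2 := two_mul_choose_two_int (2 * a)
    have hsq : 1 ≤ a ^ 2 + a ^ 2 := by nlinarith
    zify [hsq, ha]
    push_cast at h2 ⊢
    nlinarith [h2]
  · -- `n + 1 = 2a`, i.e. `n = 2a - 1`, `a ≥ 1`
    have ha : 1 ≤ a := by omega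
    obtain ⟨b, rfl⟩ : ∃ b, a = b + 1 := ⟨a - 1, by omega⟩
    have hn' : n = 2 * b + 1 := by omega
    subst hn'
    have hdiv : (2 * b + 1 - 1) / 2 = b := by omega
    have hsub : 2 * b + 1 - (b + 1) = b := by omega
    rw [hdiv, h0Real, hsub]
    have h2 := two_mul_choose_two_int (2 * b + 1)
    have hsq : 1 ≤ (b + 1) ^ 2 + b ^ 2 := by nlinarith
    zify [hsq]
    push_cast at h2 ⊢
    nlinarith [h2]
  · -- `n = 2a + 1`
    subst h
    have hdiv : (2 * a + 1 - 1) / 2 = a := by omega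
    have hsub : 2 * a + 1 - a = a + 1 := by omega
    rw [hdiv, h0Real, hsub]
    have h2 := two_mul_choose_two_int (2 * a + 1)
    have hsq : 1 ≤ a ^ 2 + (a + 1) ^ 2 := by nlinarith
    zify [hsq]
    push_cast at h2 ⊢
    nlinarith [h2]

/-- At a complex place the local term exceeds `2·C(n,2)` by exactly `n − 1`, the complex-place
contribution to `l₀`. [cite: Hansen2012, §1] -/
theorem h0Complex_eq (n : ℕ) : h0Complex n = 2 * n.choose 2 + (n - 1) := by
  rcases Nat.eq_zero_or_pos n with rfl | hn
  · simp [h0Complex]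
  · have h := sq_eq_add_two_mul_choose_two n
    simp only [h0Complex, h]
    omega

/-- **Hansen's identity for `GL_n`.**  Hansen, §1: in positive defect the numerical requirement
becomes `[F : ℚ](dim G − dim B) + l(G) = ∑_{v ∣ ∞} dim H⁰(F_v, ad⁰ r̄)`, `l(G)` the length of the
range of cohomological degrees; for `G = GL_n` and `r̄` odd at the real places (balanced
signatures) this holds on the nose with `l(G) = l₀ = r₁ ⌊(n−1)/2⌋ + r₂ (n−1)` (Khare–Thorne (6.2)):
`chtRHS D = chtLHS D + defectGL r₁ r₂ n`.  In particular the CHT deficit of an odd `r̄` is exactly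
the defect. [cite: Hansen2012, §1] [cite: KhareThorne2017, §6.1 eq. (6.2)] -/
theorem chtRHS_eq_chtLHS_add_defectGL (D : ArchData n) (hn : 1 ≤ n)
    (hodd : ∀ v, IsBalancedSignature n (D.plusMult v)) :
    chtRHS D = chtLHS D + defectGL D.r₁ D.r₂ n := by
  rw [chtLHS_eq]
  unfold chtRHS defectGL
  have hreal : (∑ v, h0Real n (D.plusMult v)) = ∑ _v : Fin D.r₁, (n.choose 2 + (n - 1) / 2) :=
    Finset.sum_congr rfl fun v _ => h0Real_eq_of_isBalanced hn (hodd v)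
  rw [hreal, h0Complex_eq]
  simp only [Finset.sum_const, Finset.card_univ, Fintype.card_fin, smul_eq_mul]
  ring


/-! ## Narrowing (barrier audit, D-0021): the coincidence for CHT's group `𝒢_n`

Clozel–Harris–Taylor §2.1 (p. 7): `𝒢_n` is the semidirect product of `GL_n × GL_1` by `{1, j}` with
`j (g, μ) j⁻¹ = (μ ᵗg⁻¹, μ)`, `ν : 𝒢_n → GL_1` sends `(g, μ) ↦ μ`, `j ↦ −1`; `ad` is the adjoint action of
`𝒢_n` on `𝔤_n = Lie GL_n`, `ad(g, μ)(x) = g x g⁻¹`, `ad(j)(x) = −ᵗx`, and "over `ℤ[1/2]` we have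
`𝔤_n^{𝒢_n} = (0)`"; likewise the coinvariants `(𝔤_n)_{𝒢_n}` vanish over `ℤ[1/2]` (`j` acts by `−1` on
`𝔤_n/𝔤_n⁰ ≅` trace), so `ad⁰ = ad = 𝔤_n` has dimension `n²` — and indeed CHT's deformation theory for
`𝒢_n` is governed by `ad r̄ = 𝔤_n` (§2.2–2.3).  For `r : Gal(F̄/F⁺) → 𝒢_n` with `r⁻¹(𝒢_n⁰) = Gal(F̄/F)`
(`F/F⁺` CM, `F⁺` totally real, `χ = ν ∘ r`) and a real place `v`, `r(c_v) = (A_v, −χ(c_v)) j` with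
`c_v² = 1`, and by Lemma 2.1.1 the pairing `⟨x, y⟩ = ᵗx A_v⁻¹ y` satisfies `⟨x, y⟩ = −χ(c_v)⟨y, x⟩`:
it is symmetric iff `χ(c_v) = −1` ("odd") and alternating iff `χ(c_v) = +1` (then `n` is even).  The
involution `ad(r(c_v)) : x ↦ −A_v ᵗx A_v⁻¹` of `𝔤𝔩_n` has fixed space `{x : x A_v = −A_v ᵗx}`, i.e.
`{S A_v⁻¹ : ᵗS = −S}` (dimension `C(n,2)`) if `A_v` is symmetric and `{S A_v⁻¹ : ᵗS = S}` (dimension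
`C(n+1,2)`) if `A_v` is alternating; in CHT's words, the archimedean term of the global Euler
characteristic is `∑_{v∣∞} n(n + χ(c_v))/2` (Lemma 2.3.4 (5), p. 31).  With
`dim 𝒢_n − dim B = (n² + 1) − (C(n+1,2) + 1) = C(n,2)` — the `l`-adic term
`[F⁺_v : ℚ_l] n(n−1)/2` of Cor. 2.3.6 and Prop. 2.5.9 — this decides (CHT) for `𝒢_n`
(`chtCoincidenceGn_iff`): it holds iff every real place is odd — in every dimension `n`; CHT
Cor. 2.3.6 (p. 33) prints the same conclusion in the form "Then `χ(c_v) = −1` for all `v ∣ ∞`", and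
Prop. 2.5.9 (pp. 60–61) counts the generators of the Taylor–Wiles rings as
`#Q − ∑_{v∈T, v∣l} [F⁺_v : ℚ_l] n(n−1)/2 − n ∑_{v∣∞} (1 + χ(c_v))/2`, i.e. exactly `n` generators
fewer per place with `χ(c_v) = +1`, so that `R_∞` falls short of the dimension `1 + #Q + n²·#T` of
the ring of diamond operators and framings by `n · #{v : χ(c_v) = +1}` — positive defect in the sense
of Calegari–Geraghty (`chtRHSGn_eq_chtLHSGn_add`).

**General form (any group).**  Both conjuncts of `TaylorWilesNumericalCoincidenceNarrow` are
instances of one criterion, CHT's 'oddness' made precise by Gross and recorded by Booher (§1,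
Remark 2, p. 4: `ρ̄ : Γ_K → G(k)` is *odd* if every `ad ρ̄(c_v)` is a split Cartan involution of
`𝔤' = Lie G^{ad}`, i.e. an involution `τ` attaining equality in `dim (𝔤')^τ ≥ dim G − dim B`; and
§3, p. 11: "it is always true that `dim (ad⁰ρ̄)^{Γ_v} ≥ [K_v : ℝ](dim G_k − dim B_k)`, so [(CHT)]
holds if and only if `K` is totally real and `ρ̄` is odd at all real places of `K`"; Remark 23,
p. 11: "for `n > 2` it is impossible to satisfy the oddness hypothesis. To obtain representations
that are odd one would need to work with `GL_n ⋊ Out(GL_n)` or related groups, as is done for `𝒢_n`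
in [CHT08]").  Quantitatively: let the automorphic forms live on a connected reductive group `H`
over `F`, so that `r(c_v)`, `v` real, is an involution in the `L`-group `ᴸH` lifting `c_v`, and
write `N = dim G − dim B` (the number of positive roots) and `ℓ = dim ad⁰ − 2N` (the rank).
Bergeron–Venkatesh prove (§6, Proposition 7 of arXiv:1004.1083, p. 21, also due to Emerton) that
every involution `θ ∈ ᴸH` lifting `c` has `tr(Ad θ) ≥ rank H_v − 2 rank K_v`, `K_v ⊂ H(F_v)`
maximal compact, with equality on a single `Ĥ`-orbit — the *odd* class; as
`dim (ad⁰)^θ = (dim ad⁰ + tr(Ad θ))/2`, a real place contributes at least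
`N + (rank H_v − rank K_v)` to the right side of (CHT), with equality iff `r(c_v)` is odd, and a
complex place contributes `dim ad⁰ = 2N + ℓ`, `ℓ = rank H_v − rank K_v` for the complex group.
Summing over `v ∣ ∞` (ranks taken modulo the centre, as in Khare–Thorne's
`l₀ = rank G_∞ − rank Z_∞K_∞`, eq. (6.2)):

  `RHS − LHS ≥ l₀(Res_{F/ℚ} H)`, with equality iff `r` is odd at every real place;

so **(CHT) holds iff `l₀ = 0` (`F` totally real and every `H(F_v)` of equal rank, i.e. with
discrete series) and `r` is totally odd** — Calegari–Geraghty's "the classical method is the case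
`l₀ = 0`" (§1, p. 2) plus oddness; Hansen (§1, p. 4) writes the positive-defect requirement as
`[F:ℚ](dim G − dim B) + l(G) = ∑_{v∣∞} dim H⁰(F_v, ad⁰ ρ̄)`.  Conjunct (1) is the case `H = GL_n`
(`ad⁰ = 𝔰𝔩_n`; `l₀ = r₁⌊(n−1)/2⌋ + r₂(n−1)`, `defectGL`, vanishing iff `n = 1` or `n = 2`, `r₂ = 0`;
`chtRHS_eq_chtLHS_add_defectGL` is the equality for odd `r`), conjunct (2) the case `H = U(n)`
relative to `F/F⁺` (`ᴸH` restricted to `Gal(F̄/F⁺)` is `𝒢_n` up to centre, `ad⁰ = 𝔤𝔩_n`,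
`rank H_v = rank K_v = n` for every signature, so `l₀ = 0`; the involutions `x ↦ −A_v ᵗx A_v⁻¹` of
the coset `𝒢_n ∖ 𝒢_n⁰` have trace `−n` — odd — for symmetric `A_v` and `+n` for alternating `A_v`,
whence the defect `n` per alternating place in `chtRHSGn_eq_chtLHSGn_add`).  Only these two
instances are formalized below; the Lie-theoretic inequality enters on paper. -/

/-- `dim 𝒢_n = dim (GL_n × GL_1) = n² + 1` (the component group `{1, j}` is finite).
[cite: ClozelHarrisTaylor2008, §2.1] -/
def dimGn (n : ℕ) : ℕ := n ^ 2 + 1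

/-- `dim B = C(n+1,2) + 1` for a Borel subgroup `B = B_n × GL_1` of `𝒢_n` (a Borel subgroup of the
identity component `GL_n × GL_1`). [cite: ClozelHarrisTaylor2008, §1] -/
def dimBorelGn (n : ℕ) : ℕ := (n + 1).choose 2 + 1

/-- `dim 𝒢_n − dim B = C(n,2)`, the same value as for `GL_n` (`dimGL_sub_dimBorelGL`). [folklore] -/
theorem dimGn_sub_dimBorelGn (n : ℕ) : dimGn n - dimBorelGn n = n.choose 2 := by
  have h := dimGL_sub_dimBorelGL n
  simp only [dimGL, dimBorelGL] at h
  simp only [dimGn, dimBorelGn]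
  omega

/-- The archimedean data entering (CHT) for `r : Gal(F̄/F⁺) → 𝒢_n(ℚ̄_l)` with
`r⁻¹(GL_n × GL_1) = Gal(F̄/F)`, `F/F⁺` a CM extension of the totally real field `F⁺` with `d ≥ 1` real
places: at the real place `v`, `r(c_v) = (A_v, −χ(c_v)) j` (`χ = ν ∘ r`) and the CHT pairing
`ᵗx A_v⁻¹ y` is symmetric (`odd v = true`, `χ(c_v) = −1`) or alternating (`odd v = false`,
`χ(c_v) = +1`, which forces `n` even since `A_v` is invertible: field `even_of_not_odd`).  "Totally odd" (Barnet-Lamb–Gee–Geraghty–Taylor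
§2.1: `ε_v = 1` for all `v ∣ ∞`) is `∀ v, odd v = true`.
[cite: ClozelHarrisTaylor2008, §2.1 Lemma 2.1.1] [cite: BarnetlambEtAl2014, §2.1] -/
structure ArchDataGn (n : ℕ) where
  /-- number of real places of the totally real field `F⁺` -/
  d : ℕ
  /-- `true` at `v` iff the CHT pairing at `v` is symmetric, i.e. `ν ∘ r(c_v) = −1` -/
  odd : Fin d → Bool
  places_pos : 0 < d
  /-- an invertible alternating `A_v` exists only in even dimension -/
  even_of_not_odd : ∀ v, odd v = false → Even n

/-- `dim H⁰(Gal(ℂ/ℝ), ad r) = n(n + χ(c_v))/2` for `𝒢_n` at a real place (Clozel–Harris–Taylor,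
Lemma 2.3.4 (5), p. 31, via their Lemma 2.1.3): the fixed space of `x ↦ −A ᵗx A⁻¹` on `𝔤𝔩_n` is
`{S A⁻¹ : ᵗS = −S}` (dimension `C(n,2) = n(n−1)/2`, `χ(c_v) = −1`) for symmetric `A` and
`{S A⁻¹ : ᵗS = S}` (dimension `C(n+1,2) = n(n+1)/2`, `χ(c_v) = +1`) for alternating `A`.
[cite: ClozelHarrisTaylor2008, §2.3 Lemma 2.3.4] -/
def h0RealGn (n : ℕ) (odd : Bool) : ℕ := if odd then n.choose 2 else (n + 1).choose 2

/-- `h0RealGn n b = C(n,2) + (0 if odd, n if even)`, from `C(n+1,2) = C(n,2) + n`. [folklore] -/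
theorem h0RealGn_eq (n : ℕ) (b : Bool) : h0RealGn n b = n.choose 2 + (if b then 0 else n) := by
  cases b
  · simp [h0RealGn, Nat.choose_succ_succ, Nat.choose_one_right, Nat.add_comm]
  · simp [h0RealGn]

/-- Left side of (CHT) for `G = 𝒢_n` over `F⁺`: `[F⁺ : ℚ](dim 𝒢_n − dim B)` with `[F⁺ : ℚ] = d`.
[cite: ClozelHarrisTaylor2008, §1] -/
def chtLHSGn (E : ArchDataGn n) : ℕ := E.d * (dimGn n - dimBorelGn n)

/-- Right side of (CHT) for `G = 𝒢_n`: `∑_{v ∣ ∞} dim H⁰(Gal(F̄⁺_v/F⁺_v), ad r)`.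
[cite: ClozelHarrisTaylor2008, §1] -/
def chtRHSGn (E : ArchDataGn n) : ℕ := ∑ v, h0RealGn n (E.odd v)

/-- The Taylor–Wiles numerical coincidence of Clozel–Harris–Taylor for `G = 𝒢_n` and the archimedean
data `E`. [cite: ClozelHarrisTaylor2008, §1] -/
def CHTCoincidenceGn (E : ArchDataGn n) : Prop := chtLHSGn E = chtRHSGn E

/-- The number of real places of alternating sign (`ν ∘ r(c_v) = +1`). [cite: BarnetlambEtAl2014, §2.1] -/
def ArchDataGn.evenPlaces (E : ArchDataGn n) : ℕ := (univ.filter fun v => E.odd v = false).card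

/-- **(CHT) for `𝒢_n`, exactly**: `RHS = LHS + n · #{even places}` — each place of alternating sign costs
exactly `n = C(n+1,2) − C(n,2)` in the Selmer-rank count.  This is the defect term
`− n ∑_{v∣∞} (1 + χ(c_v))/2` in Clozel–Harris–Taylor's count of topological generators of the
Taylor–Wiles rings `R_{S(Q)}` over the local ring, `#Q − ∑_{v∈T, v∣l} [F⁺_v : ℚ_l] n(n−1)/2 −
n ∑_{v∣∞} (1 + χ(c_v))/2` (Lemma 2.5.8, Prop. 2.5.9, pp. 60–61): each place with `χ(c_v) = +1`
removes `n` generators, and the patched deformation ring is then `n · #{v : χ(c_v) = +1}` dimensions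
smaller than the ring of diamond operators and framings.
[cite: ClozelHarrisTaylor2008, §2.5 Prop. 2.5.9] -/
theorem chtRHSGn_eq_chtLHSGn_add (E : ArchDataGn n) :
    chtRHSGn E = chtLHSGn E + n * E.evenPlaces := by
  unfold chtRHSGn chtLHSGn ArchDataGn.evenPlaces
  rw [dimGn_sub_dimBorelGn]
  simp_rw [h0RealGn_eq]
  rw [Finset.sum_add_distrib]
  simp only [Finset.sum_const, Finset.card_univ, Fintype.card_fin, smul_eq_mul]
  congr 1
  rw [Finset.card_eq_sum_ones, Finset.mul_sum, Finset.sum_filter]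
  refine Finset.sum_congr rfl fun v _ => ?_
  cases E.odd v <;> simp

/-- For `𝒢_n` too the coincidence can only fail by a deficit. [cite: ClozelHarrisTaylor2008, §1] -/
theorem chtLHSGn_le_chtRHSGn (E : ArchDataGn n) : chtLHSGn E ≤ chtRHSGn E := by
  rw [chtRHSGn_eq_chtLHSGn_add]
  exact Nat.le_add_right _ _

/-- **The numerical coincidence for `𝒢_n`, decided**: for `n ≥ 1` it holds iff `r` is odd
(symmetric CHT pairing, `χ(c_v) = ν ∘ r(c_v) = −1`) at every real place of `F⁺` — in every dimension
`n`; this is CHT's "In this setting the Taylor–Wiles argument carries over well" (§1, p. 2), their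
Cor. 2.3.6 (p. 33: if `R_S^univ` is to be `𝒪` with the `l`-adic terms `[F⁺_v : ℚ_l] n(n−1)/2`, "Then
`χ(c_v) = −1` for all `v ∣ ∞`"), the standing hypothesis "For each infinite place `v` of `F⁺` we have
`χ(c_v) = −1`" of their lifting theorems (Thm. 2.6.3, p. 64), and BLGGT's hypothesis "totally odd, essentially
conjugate self-dual" (`ε_v = 1` for all `v ∣ ∞`, §2.1 p. 17).
[cite: ClozelHarrisTaylor2008, §2.3 Cor. 2.3.6] [cite: BarnetlambEtAl2014, §2.1] -/
theorem chtCoincidenceGn_iff (E : ArchDataGn n) (hn : 1 ≤ n) :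
    CHTCoincidenceGn E ↔ ∀ v, E.odd v = true := by
  unfold CHTCoincidenceGn
  rw [chtRHSGn_eq_chtLHSGn_add]
  constructor
  · intro h v
    have h0 : n * E.evenPlaces = 0 := by omega
    have hE : E.evenPlaces = 0 := by
      rcases Nat.mul_eq_zero.1 h0 with h | h
      · omega
      · exact h
    unfold ArchDataGn.evenPlaces at hE
    rw [Finset.card_eq_zero, Finset.filter_eq_empty_iff] at hE
    have := hE (Finset.mem_univ v)
    cases hv : E.odd v <;> simp_all
  · intro h
    have hE : E.evenPlaces = 0 := by
      unfold ArchDataGn.evenPlaces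
      rw [Finset.card_eq_zero, Finset.filter_eq_empty_iff]
      intro v _
      simp [h v]
    rw [hE, mul_zero, add_zero]

/-- The totally odd datum over a totally real `F⁺` of degree `d` (every CHT pairing symmetric), e.g. the
`𝒢_n`-valued representation attached to a RACSDC automorphic representation of `GL_n(𝔸_F)`
(Barnet-Lamb–Gee–Geraghty–Taylor §2.1, citing Bellaïche–Chenevier for the sign).
[cite: BarnetlambEtAl2014, §2.1] -/
def ArchDataGn.totallyOdd (n d : ℕ) (hd : 0 < d) : ArchDataGn n where
  d := d
  odd := fun _ => true
  places_pos := hd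
  even_of_not_odd := fun v h => by simp at h

/-- (CHT) holds for `𝒢_n` and totally odd `r`, for every `n` and every totally real `F⁺`.
[cite: ClozelHarrisTaylor2008, §1] -/
theorem chtCoincidenceGn_totallyOdd (n d : ℕ) (hd : 0 < d) :
    CHTCoincidenceGn (ArchDataGn.totallyOdd n d hd) := by
  unfold CHTCoincidenceGn
  rw [chtRHSGn_eq_chtLHSGn_add]
  have hE : (ArchDataGn.totallyOdd n d hd).evenPlaces = 0 := by
    unfold ArchDataGn.evenPlaces ArchDataGn.totallyOdd
    simp
  rw [hE, mul_zero, add_zero]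

/-- The datum of alternating sign at every place, dimension `2k`. [cite: BarnetlambEtAl2014, §2.1] -/
def ArchDataGn.totallyEven (k d : ℕ) (hd : 0 < d) : ArchDataGn (2 * k) where
  d := d
  odd := fun _ => false
  places_pos := hd
  even_of_not_odd := fun _ _ => ⟨k, by ring⟩

/-- With the alternating sign the coincidence fails for `𝒢_{2k}`, `k ≥ 1` (deficit `2k` per place).
[cite: ClozelHarrisTaylor2008, §1] -/
theorem not_chtCoincidenceGn_totallyEven (k d : ℕ) (hk : 1 ≤ k) (hd : 0 < d) :
    ¬ CHTCoincidenceGn (ArchDataGn.totallyEven k d hd) := by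
  rw [chtCoincidenceGn_iff _ (by omega)]
  intro h
  have := h ⟨0, hd⟩
  simp [ArchDataGn.totallyEven] at this

/-- **BARRIER (narrowed by audit, D-0021): defect-zero Taylor–Wiles patching is blocked for a
`GL_n`-valued `r` exactly when `r` has no totally odd polarization.**  Conjunction of the two decided
criteria: (1) for `G = GL_n` (unpolarized deformation theory) the coincidence holds iff `n = 1`, or
`n = 2`, `F` totally real and `r` odd at every real place (`chtCoincidenceGL_iff`); (2) for CHT's
`G = 𝒢_n` over a totally real `F⁺` (polarized deformation theory of `r : G_F → GL_n`, `F/F⁺` CM,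
`r^c ≅ r^∨ ⊗ χ`) it holds, in every dimension `n ≥ 1`, iff the CHT pairing is symmetric at every real
place (`chtCoincidenceGn_iff`).  Clozel–Harris–Taylor §1: p. 1 "not if `G = GL_n` for `n > 2`"; p. 2
"This choice [`𝒢_n`] can give us information about certain Galois representations
`r : Gal(F̄/F) → GL_n(ℚ̄_l)`, where `F` is a CM field … In this setting the Taylor–Wiles argument
carries over well".  Booher §1 (p. 4): "This coincidence cannot hold for `GL_n` when `n > 2`, but can
hold for `G = GSp_{2n}` and `G = GO_m` when `m ≢ 2 (mod 4)`, and for the group `𝒢_n` related to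
`GL_n` considered in [CHT08]."  PROVED below (`TaylorWilesNumericalCoincidenceNarrow_holds`); its
first conjunct is literally
`TaylorWilesNumericalCoincidence` (`TaylorWilesNumericalCoincidenceNarrow_iff`).

BARRIER (structured block, D-0021):
- technique_class: taylor-wiles patching automorphy-lifting defect-zero
- blocks: automorphy (Galois → automorphic direction of the summit `Langlands`; `Literature.NumberTheory.Automorphic.FontaineMazurLanglandsGLn`, `Literature/NumberTheory/Automorphic/ReciprocityGLn`) of `r : Gal(F̄/F) → GL_n(ℚ̄_l)` by Taylor–Wiles–Kisin patching in a single cohomological degree ONLY for `r` without a totally odd polarization, namely when (α) `F` is neither totally real nor CM and `n ≥ 2`, or (β) `F` is CM (resp. totally real) and there is no character `χ` with `r^c ≅ r^∨ ⊗ χ` (resp. `r ≅ r^∨ ⊗ χ`) whose CHT pairing is symmetric at every `v ∣ ∞` (`ε_v = 1`, [cite: BarnetlambEtAl2014, §2.1]) — e.g. `n ≥ 3` and `r` not essentially (conjugate) self-dual (the generic regular `r` over a CM field of [ACC+]), `n = 2` over CM `F` with `r` not a twist of a base change from `F⁺` nor otherwise polarizable, `n = 2` over totally real `F` with `r` even at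 some real place, or a polarization of alternating sign; polarizable totally odd `r` (RACSDC / RAESDC, any `n`) are NOT blocked: CHT, BLGGT prove their automorphy lifting by defect-zero patching on definite unitary groups [cite: ClozelHarrisTaylor2008, §1]
- because: the Greenberg–Wiles count balances generators and Taylor–Wiles relations iff (CHT) holds for the group `G` in which the deformation theory is valued; for `G = GL_n` the archimedean terms exceed `[F_v : ℝ]·C(n,2)` unless `n ≤ 2`, `v` real, `r(c_v)` odd (`chtCoincidenceGL_iff`: equality `dim 𝔤^θ = dim G − dim B` requires `θ` to be the Cartan involution of the split real form, which for `𝔰𝔩_n`, `n ≥ 3`, is the outer involution `x ↦ −ᵗx`, not attained by any `Ad r(c_v)`, `r(c_v) ∈ GL_n`), whereas for `G = 𝒢_n` the element `j` makes `x ↦ −ᵗx` available and `dim (𝔤𝔩_n)^{ad r(c_v)} = n(n + χ(c_v))/2` [cite: ClozelHarrisTaylor2008, §2.3 Lemma 2.3.4] equals `C(n,2) = dim 𝒢_n − dim B` exactly when the pairing at `v` is symmetric (`χ(c_v) = −1`), and `C(n+1,2)` when alternating, so that CHT's generator count for the Taylor–Wiles rings drops by `n ∑_{v∣∞}(1 +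 χ(c_v))/2` and the patched deformation ring is that many dimensions smaller than the ring of diamond operators [cite: ClozelHarrisTaylor2008, §2.5 Prop. 2.5.9] (`chtRHSGn_eq_chtLHSGn_add`: defect `n` per alternating place) [cite: Booher2019, §1]
- evasions_known: those of `TaylorWilesNumericalCoincidence` (positive-defect patching [cite: CalegariGeraghty2017, §1] [cite: ACCGHLNSTT2023, §1]; functorial descent of parity, `Sym²` of even `r` [cite: Calegari2023, §9.7]); within defect zero the only lever is the choice of `G`: make `r` polarizable by a functorial operation and descend (potential automorphy over a larger CM/totally real field plus solvable descent where available) [cite: BarnetlambEtAl2014, §2.1]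
- scope_caveats: (a) distinct Hodge–Tate weights at all `v ∣ p` and `l > 2` presumed (the `p`-adic term `[F : ℚ](dim G − dim B)` is the regular-weight value [cite: CalegariGeraghty2017, §1]); (b) conjunct (2) is the count for CHT's polarized deformation problem with fixed multiplier character; the totally real essentially self-dual case (`r` through `GSp_n` with totally odd, or `GO_n` with totally even, multiplier — BLGGT §2.1 p. 17, "`F` CM (or totally real)") is treated in [CHT, BLGGT] inside the same `𝒢_n` formalism and is not given a separate `GSp`/`GO` count here [cite: BarnetlambEtAl2014, §2.1]; (c) an `r` whose deformation theory is valued in another (possibly disconnected) reductive `G` — the `L`-group of the group `H/F` carrying the automorphic forms: similitude groups, tensor products, inductions, symmetric powers, exceptional images — is governed by (CHT) for that `G`, CHT's general 'oddness': `F` totally real (or `ad⁰ = (0)`) and `Ad r(c_v)` a split Cartan involution of `ad⁰` (`dim (ad⁰)^{Ad r(c_v)} = dim G − dim B`) at every `v ∣ ∞` [cite: Booher2019, §1]; by the Bergeron–Venkatesh–Emerton bound `tr(Ad θ) ≥ rank H_v − 2 rank K_v` for involutions `θ ∈ ᴸH` over `c` (equality on one `Ĥ`-orbit, the odd class) the general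 form of both conjuncts is `RHS − LHS ≥ l₀(Res_{F/ℚ} H)` with equality iff `r` is totally odd, so that (CHT) holds iff `l₀ = 0` and `r` is totally odd (§Narrowing, *General form*) [cite: BergeronVenkatesh2012, §6] [cite: CalegariGeraghty2017, §1]; only the instances `H = GL_n` and `H = U(n)` (`G = 𝒢_n`) are formalized here, the Lie-theoretic inequality entering on paper [cite: ClozelHarrisTaylor2008, §1]; (d) as for the original entry, this is CHT's diagnosis of the method, not an impossibility theorem for patching at large [cite: CalegariGeraghty2017, §1]
- status: established (both conjuncts proved here; attribution of the requirement to the method is CHT's [cite: ClozelHarrisTaylor2008, §1])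
-/
def TaylorWilesNumericalCoincidenceNarrow : Prop :=
  (∀ (n : ℕ) (D : ArchData n), 1 ≤ n →
      (CHTCoincidenceGL D ↔ n = 1 ∨ (n = 2 ∧ D.r₂ = 0 ∧ ∀ v, D.plusMult v = 1))) ∧
    ∀ (n : ℕ) (E : ArchDataGn n), 1 ≤ n → (CHTCoincidenceGn E ↔ ∀ v, E.odd v = true)

/-- The narrowed barrier is the original criterion for `GL_n` together with the `𝒢_n` criterion.
[cite: ClozelHarrisTaylor2008, §1] -/
theorem TaylorWilesNumericalCoincidenceNarrow_iff :
    TaylorWilesNumericalCoincidenceNarrow ↔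
      TaylorWilesNumericalCoincidence ∧
        ∀ (n : ℕ) (E : ArchDataGn n), 1 ≤ n → (CHTCoincidenceGn E ↔ ∀ v, E.odd v = true) :=
  Iff.rfl

/-- Discharge of `TaylorWilesNumericalCoincidenceNarrow` (`chtCoincidenceGL_iff`, `chtCoincidenceGn_iff`).
[cite: ClozelHarrisTaylor2008, §1] -/
theorem TaylorWilesNumericalCoincidenceNarrow_holds : TaylorWilesNumericalCoincidenceNarrow :=
  ⟨TaylorWilesNumericalCoincidence_holds, fun _n E hn => chtCoincidenceGn_iff E hn⟩

/-- Sanity instance (decided by `decide`): `𝒢_3` over a real quadratic `F⁺`, totally odd — the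
coincidence holds (`LHS = RHS = 6`), although it fails for `GL_3` over every field
(`not_chtCoincidenceGL_of_three_le`). [cite: ClozelHarrisTaylor2008, §1] -/
theorem chtCoincidenceGn_three_realQuadratic :
    CHTCoincidenceGn (ArchDataGn.totallyOdd 3 2 (by norm_num)) := by
  unfold CHTCoincidenceGn; decide

/-- Sanity instance (decided by `decide`): `𝒢_4` over `ℚ` with alternating sign — `LHS = 6`,
`RHS = C(5,2) = 10`, deficit `4 = n`. [cite: ClozelHarrisTaylor2008, §1] -/
theorem chtGn_four_alternating :
    chtLHSGn (ArchDataGn.totallyEven 2 1 (by norm_num)) = 6 ∧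
      chtRHSGn (ArchDataGn.totallyEven 2 1 (by norm_num)) = 10 := by
  decide

end Literature.Barriers.Langlands
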